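import Summits.BirchSwinnertonDyer.BirchSwinnertonDyer.Theorems.AlignedTransportAtTwoMainConjectureOfRankZeroBSDAtTwoResolventParity
import Literature.NumberTheory.IwasawaTheory.FerreroKidaLambdaTwoImaginaryQuadratic
import Literature.NumberTheory.IwasawaTheory.FerreroKidaSumParity
import HarnessLib

/-!
# Route `AlignedTransportAtTwo`, crux C2 `MainConjectureOfRankZeroBSDAtTwo` (stmt-BirchSwinnertonDyer-22298):
# THE PARITY BIT MADE EXPLICIT — Ferrero–Kida's `λ₂(ℚ(√−d)) = −1 + Σ_{p ∣ d odd} 2^{ord₂(p²−1)−3}` is ODD iff `d ≡ ±1 (mod 8)`; on the Kilford sub-cell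
# (`Δ_W = −d·q²`, `d ≡ 7 (mod 8)`) the sextic's `λ₂(ℚ(W[2]))` is therefore ODD, and a rank certificate of value `3` OR `4` pins `λ₂(ℚ(W[2])) = 3`

HONEST FRAMING (cell `bsd-f1-sign2`, WIDTH-5 attached prover seat `bsd-line-att-p3` gen 29, line `birth`, lead `bsd-line-att-p2`; `--supports`
stmt-BirchSwinnertonDyer-22298, closes nothing; BSD is NOT proved; the crux C2, its verdict «blocked-on `Rank1Residual.GreenbergMuConjectureIrreducible`» and every
registered stub untouched).  THEOREMS ONLY — no definition, no named fact, no `sorry`.  The PRINT input is the Literature named fact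
`IwasawaTheory.ferreroKida_classicalLambda_two_imaginaryQuadratic` = Ferrero 1980 / Kida 1979 (Schettler 2014, Thm. 2, held and read: «Let `d > 2` be a squarefree
integer. Then `λ₂(ℚ(√−d)) = −1 + Σ_{p ∣ d, p ≠ 2} 2^{ord₂(p²−1)−3}`»; this seat's `Literature/NumberTheory/IwasawaTheory/FerreroKidaLambdaTwoImaginaryQuadratic.lean`,
statement only) together with the theorems-only `Literature/NumberTheory/IwasawaTheory/FerreroKidaSumParity.lean` (the unconditional arithmetic «the sum is
even iff `d ≡ ±1 (mod 8)`», `χ₈` being multiplicative).  §2 here is the reading aid «`λ₂(ℚ(√−d))` odd iff `d ≡ ±1 (mod 8)`» (conditional).  Every theorem below that uses the fact carries it as the displayed hypothesis `hFK` (CONDITIONAL results); `mod_eight_eq_seven_of_onKilfordStratumAtTwo`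
and the §3 lemmas are unconditional.

* §3 (conditional) the resolvent of an elliptic `W/ℚ` with `Δ_W = −d·q²` (`d` odd squarefree `> 2`, `q ∈ ℚˣ`): `μ₂(ℚ(√Δ_W)) = 0` and, granted `μ₂(ℚ(W[2])) = 0`,
  ★ **`λ₂(ℚ(W[2]))` is ODD iff `d ≡ ±1 (mod 8)`** (`odd_classicalLambda_divisionField_two_iff_of_ferreroKida`; this seat's parity law `…ResolventParity`).
* §4 (conditional) the Kilford sub-cell: `mod_eight_eq_seven_of_onKilfordStratumAtTwo` (ON the stratum, `Δ_W ∈ ℚ₂ײ` forces `d ≡ 7 (mod 8)`, unconditional),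
  ★ `odd_classicalLambda_divisionField_two_of_onKilfordStratumAtTwo` (**`λ₂(ℚ(W[2]))` is ODD**), ★ `classicalLambda_eq_three_of_rankCert_le_four`
  (**a 2-rank certificate of value `≤ 4` pins `λ₂(ℚ(W[2])) = 3`** — g28 had this for value `3` only), `classicalLambda_resolvent_odd_of_onKilfordStratumAtTwo`.

* §5 (appended; conditional on `hFK`) ★ `ferreroKidaSum_le_classicalLambda_divisionField_two_succ` — the QUANTITATIVE bound **`λ₂(ℚ(W[2])) + 1 ≥ Σ_{p ∣ d} 2^{ord₂(p²−1)−3}`**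
  (= `λ₂(ℚ(√−d)) + 1`) and `…_le_classGroupPRank_succ_of_rankCert` (a certificate of value `r` has `r + 1 ≥ Σ`); census: 7831a1 `λ₂(T) ≥ 17`, 24213c1 `λ₂(T) ≥ 33`.

PARTITION CURRENCY (D-0171): on the `Δ_W < 0` seed cell with good reduction at `2` (`Δ_min` odd, so `d ≡ −Δ_min (mod 8)`), granted `μ₂ = 0` and `hFK`:
`λ₂(ℚ(W[2]))` is ODD on `Δ_min ≡ 1, 7 (mod 8)` (the Kilford stratum and one off-stratum class; on `Δ_min ≡ 7` read `d ≡ 1`, excluding `d = 1`) and EVEN on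
`Δ_min ≡ 3, 5 (mod 8)`.  Nothing is closed; the law constrains the certificate the crux predicts, it does not produce it.

References: [Schettler2014] J. Schettler, *An alternative approach to Kida and Ferrero's computations of Iwasawa λ-invariants*, J. Number Theory 138 (2014), Thm. 2
(held: arXiv:1211.1727, p. 3); [Ferrero1980] B. Ferrero, Amer. J. Math. 102 (1980) 447–459; [Kida1979] Y. Kida, Tôhoku Math. J. 31 (1979) 91–96;
[Washington1997] Thm. 10.8, §13.3; this seat's p761326 / p761479 / p761618 (`…ResolventParity`) and the Literature fact file.
-/

set_option linter.dupNamespace false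
set_option autoImplicit false

noncomputable section

open scoped Classical NumberField

namespace Summit.BirchSwinnertonDyer.BirchSwinnertonDyer.Theorems.AlignedTransportAtTwoResolventLambdaParity

open Polynomial WeierstrassCurve IntermediateField Field NumberField Finset
  Literature.NumberTheory.EllipticCurves Literature.NumberTheory.EllipticCurves.Greenberg1999 Literature.NumberTheory.GaloisRepresentations
  Literature.NumberTheory.IwasawaTheory Literature.NumberTheory.NumberFields
  Summit.BirchSwinnertonDyer.Rank1Residual.F1Sign2
  Summit.BirchSwinnertonDyer.BirchSwinnertonDyer.Theorems.AlignedTransportAtTwoCubicClosureParity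
  Summit.BirchSwinnertonDyer.BirchSwinnertonDyer.Theorems.AlignedTransportAtTwoGreenbergFieldLambda
  Summit.BirchSwinnertonDyer.BirchSwinnertonDyer.Theorems.AlignedTransportAtTwoKilfordStratumShared
  Summit.BirchSwinnertonDyer.BirchSwinnertonDyer.Theorems.AlignedTransportAtTwoKilfordStratum
  Summit.BirchSwinnertonDyer.BirchSwinnertonDyer.Theorems.AlignedTransportAtTwoResolventParity
  Summit.BirchSwinnertonDyer.BirchSwinnertonDyer.Theorems.AlignedTransportAtTwoRankCertificateLambda

/-! ## §2 Imaginary quadratic `K ∋ √−d`: `λ₂(K)` is odd iff `d ≡ ±1 (mod 8)` (conditional on the named fact) -/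

/-- ★ **`λ₂(K)` is ODD iff `d ≡ ±1 (mod 8)`** for `K` quadratic containing `δ` with `δ² = −d`, `d > 2` odd squarefree, `κ` any cyclotomic `ℤ₂`-extension of `K`
(and `μ₂(K) = 0`) — CONDITIONAL on the Ferrero–Kida fact `hFK`. [cite: Schettler2014, Thm. 2] [cite: Ferrero1980, main theorem (original; not held)] -/
theorem odd_classicalLambda_iff_of_ferreroKida (hFK : ferreroKida_classicalLambda_two_imaginaryQuadratic) {K : Type} [Field K] [NumberField K]
    {d : ℕ} (hd : Squarefree d) (hodd : Odd d) (h2 : 2 < d) (hK : Module.finrank ℚ K = 2) (hδ : ∃ δ : K, δ ^ 2 = -((d : ℕ) : K))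
    (κ : ZpExtension K 2) (hκ : κ.IsCyclotomic) :
    ClassicalMuVanishes κ ∧ (Odd (classicalLambda κ) ↔ (d % 8 = 1 ∨ d % 8 = 7)) := by
  obtain ⟨hμ, hl⟩ := hFK K d hd h2 hK hδ κ hκ
  refine ⟨hμ, ?_⟩
  rw [← ferreroKidaSum_mod_two_eq_zero_iff hd hodd, ← hl, Nat.odd_iff]
  omega


/-! ## §3 The resolvent `ℚ(√Δ_W)`, `Δ_W = −d·q²`: the parity of `λ₂(ℚ(W[2]))` from `d mod 8` -/

variable (W : WeierstrassCurve ℚ) [W.IsElliptic]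

omit [W.IsElliptic] in
/-- `Δ_W = −d·q²` with `d > 2` squarefree and `q ≠ 0` ⟹ `Δ_W ∉ ℚ²` (a rational square is `≥ 0`). [folklore] -/
theorem not_isSquare_Δ_of_eq_neg_mul_sq {d : ℕ} (h2 : 2 < d) {q : ℚ} (hq : q ≠ 0) (hΔ : W.Δ = -(d : ℚ) * q ^ 2) : ¬ IsSquare W.Δ := by
  rintro ⟨r, hr⟩
  have hq2 : 0 < q ^ 2 := by positivity
  have hd : (0 : ℚ) < d := by exact_mod_cast (by omega : 0 < d)
  nlinarith [mul_self_nonneg r]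

omit [W.IsElliptic] in
/-- In `K = ℚ(δ)`, `δ² = Δ_W = −d·q²`: the element `δ/q ∈ K` has square `−d`, and `[K : ℚ] = 2`. [folklore] -/
theorem exists_sq_eq_neg_of_sq_eq {d : ℕ} (h2 : 2 < d) {q : ℚ} (hq : q ≠ 0) (hΔ : W.Δ = -(d : ℚ) * q ^ 2)
    {δ : AlgebraicClosure ℚ} (hδ : δ ^ 2 = ((W.Δ : ℚ) : AlgebraicClosure ℚ)) :
    Module.finrank ℚ ℚ⟮δ⟯ = 2 ∧ ∃ η : ℚ⟮δ⟯, η ^ 2 = -((d : ℕ) : ℚ⟮δ⟯) := by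
  refine ⟨finrank_adjoin_eq_two_of_sq_eq hδ (not_isSquare_Δ_of_eq_neg_mul_sq W h2 hq hΔ), ⟨AdjoinSimple.gen ℚ δ * ((q⁻¹ : ℚ) : ℚ⟮δ⟯), ?_⟩⟩
  apply (algebraMap ℚ⟮δ⟯ (AlgebraicClosure ℚ)).injective
  rw [map_pow, map_mul, AdjoinSimple.algebraMap_gen, map_neg, map_natCast, mul_pow, hδ, hΔ]
  have hq' : ((q : ℚ) : AlgebraicClosure ℚ) ≠ 0 := by exact_mod_cast hq
  have : algebraMap ℚ⟮δ⟯ (AlgebraicClosure ℚ) ((q⁻¹ : ℚ) : ℚ⟮δ⟯) = ((q⁻¹ : ℚ) : AlgebraicClosure ℚ) := by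
    rw [← map_ratCast (algebraMap ℚ⟮δ⟯ (AlgebraicClosure ℚ)) q⁻¹]
  rw [this]
  push_cast
  field_simp

/-- ★ **The parity of `λ₂(ℚ(W[2]))` from `d mod 8`** — `W/ℚ` elliptic with `Δ_W = −d·q²` (`d > 2` odd squarefree, `q ∈ ℚˣ`), `δ² = Δ_W`, `κ`, `κT` ANY cyclotomic
`ℤ₂`-extensions of `ℚ(δ) = ℚ(√−d)` and `ℚ(W[2])`; granted `μ₂(ℚ(W[2])) = 0` (growth form) and CONDITIONAL on Ferrero–Kida (`hFK`):
`μ₂(ℚ(√−d)) = 0`, **`λ₂(ℚ(√−d))` odd iff `d ≡ ±1 (mod 8)`**, and — by this seat's resolvent parity law — **`λ₂(ℚ(W[2]))` odd iff `d ≡ ±1 (mod 8)`**.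
[cite: Schettler2014, Thm. 2] [cite: Washington1997, Thm. 10.8 and §13.3 Thm. 13.13] -/
theorem odd_classicalLambda_divisionField_two_iff_of_ferreroKida (hFK : ferreroKida_classicalLambda_two_imaginaryQuadratic)
    {d : ℕ} (hd : Squarefree d) (hodd : Odd d) (h2 : 2 < d) {q : ℚ} (hq : q ≠ 0) (hΔ : W.Δ = -(d : ℚ) * q ^ 2)
    {δ : AlgebraicClosure ℚ} (hδ : δ ^ 2 = ((W.Δ : ℚ) : AlgebraicClosure ℚ)) (κ : ZpExtension ℚ⟮δ⟯ 2) (hκ : κ.IsCyclotomic)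
    (κT : ZpExtension (W.divisionField 2) 2) (hκT : κT.IsCyclotomic) (hμ : ClassicalMuVanishes κT) :
    (ClassicalMuVanishes κ ∧ (Odd (classicalLambda κ) ↔ (d % 8 = 1 ∨ d % 8 = 7))) ∧
      (Odd (classicalLambda κT) ↔ (d % 8 = 1 ∨ d % 8 = 7)) := by
  have hδint : IsIntegral ℚ δ := ((AlgebraicClosure.isAlgebraic ℚ).isAlgebraic δ).isIntegral
  haveI : FiniteDimensional ℚ ℚ⟮δ⟯ := IntermediateField.adjoin.finiteDimensional hδint
  haveI : NumberField ℚ⟮δ⟯ := NumberField.mk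
  obtain ⟨hK2, hη⟩ := exists_sq_eq_neg_of_sq_eq W h2 hq hΔ hδ
  have hk := odd_classicalLambda_iff_of_ferreroKida hFK hd hodd h2 hK2 hη κ hκ
  obtain ⟨-, -, hpar⟩ := classicalLambda_divisionField_two_modEq_two_resolvent W (not_isSquare_Δ_of_eq_neg_mul_sq W h2 hq hΔ) hδ κ hκ κT hκT hμ
  refine ⟨hk, ?_⟩
  rw [← hk.2, Nat.odd_iff, Nat.odd_iff]
  have : classicalLambda κT % 2 = classicalLambda κ % 2 := hpar
  omega

/-! ## §4 The Kilford sub-cell: `d ≡ 7 (mod 8)`, `λ₂(ℚ(W[2]))` is ODD, certificates of value `≤ 4` pin `λ₂ = 3` -/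

omit [W.IsElliptic] in
/-- **ON the Kilford stratum, `d ≡ 7 (mod 8)`** (unconditional): `Δ_W ∈ ℚ₂ײ` (tree `isSquare_padic_Δ_of_onKilfordStratumAtTwo`) and `Δ_W = −d·q²` make `−d` a
`2`-adic square, so `−d ≡ 1 (mod 8)` for odd `d` (tree `emod_eight_eq_one_of_isSquare_padic_two`). [cite: Serre1973, Ch. II §3.3 Thm. 4] -/
theorem mod_eight_eq_seven_of_onKilfordStratumAtTwo (hs : OnKilfordStratumAtTwo W) {d : ℕ} (hodd : Odd d) {q : ℚ} (hq : q ≠ 0)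
    (hΔ : W.Δ = -(d : ℚ) * q ^ 2) : d % 8 = 7 := by
  have hsq : IsSquare ((W.Δ : ℚ) : ℚ_[2]) := isSquare_padic_Δ_of_onKilfordStratumAtTwo W hs
  have hsq' : IsSquare (((-(d : ℤ) : ℤ) : ℚ_[2])) := by
    obtain ⟨r, hr⟩ := hsq
    refine ⟨r / (q : ℚ_[2]), ?_⟩
    have hq' : ((q : ℚ) : ℚ_[2]) ≠ 0 := by exact_mod_cast hq
    rw [hΔ] at hr
    push_cast at hr ⊢
    field_simp
    linear_combination hr
  have hoddz : Odd (-(d : ℤ)) := ((Int.odd_coe_nat d).mpr hodd).neg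
  have h := emod_eight_eq_one_of_isSquare_padic_two hoddz hsq'
  omega

/-- ★ **`λ₂(ℚ(W[2])^{cyc})` is ODD on the Kilford sub-cell** — `W/ℚ` elliptic ON the Kilford stratum with `Δ_W = −d·q²` (`d > 2` odd squarefree, `q ∈ ℚˣ`; `Δ_W < 0` is
automatic), `κT` any cyclotomic `ℤ₂`-extension of `ℚ(W[2])` with `μ = 0` (the C2 input); CONDITIONAL on Ferrero–Kida (`hFK`).  Also `μ₂(ℚ(√Δ_W)) = 0` and `λ₂(ℚ(√Δ_W))` odd.
[cite: Schettler2014, Thm. 2] [cite: Washington1997, Thm. 10.8 and §13.3 Thm. 13.13] -/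
theorem odd_classicalLambda_divisionField_two_of_onKilfordStratumAtTwo (hFK : ferreroKida_classicalLambda_two_imaginaryQuadratic)
    (hs : OnKilfordStratumAtTwo W) {d : ℕ} (hd : Squarefree d) (hodd : Odd d) (h2 : 2 < d) {q : ℚ} (hq : q ≠ 0) (hΔ : W.Δ = -(d : ℚ) * q ^ 2)
    {δ : AlgebraicClosure ℚ} (hδ : δ ^ 2 = ((W.Δ : ℚ) : AlgebraicClosure ℚ)) (κ : ZpExtension ℚ⟮δ⟯ 2) (hκ : κ.IsCyclotomic)
    (κT : ZpExtension (W.divisionField 2) 2) (hκT : κT.IsCyclotomic) (hμ : ClassicalMuVanishes κT) :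
    ClassicalMuVanishes κ ∧ Odd (classicalLambda κ) ∧ Odd (classicalLambda κT) := by
  have h7 := mod_eight_eq_seven_of_onKilfordStratumAtTwo W hs hodd hq hΔ
  obtain ⟨⟨hμk, hk⟩, hT⟩ := odd_classicalLambda_divisionField_two_iff_of_ferreroKida W hFK hd hodd h2 hq hΔ hδ κ hκ κT hκT hμ
  exact ⟨hμk, hk.mpr (Or.inr h7), hT.mpr (Or.inr h7)⟩

/-- ★ **A 2-rank certificate of value `≤ 4` pins `λ₂(ℚ(W[2])^{cyc}) = 3` on the Kilford sub-cell** (CONDITIONAL on `hFK`): g28's sandwich `3 ≤ λ₂(T) ≤ r` (tree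
`three_le_classicalLambda_and_le_of_rankCert_divisionField_two`; `W` with no rational `2`-torsion abscissa, `Δ_W < 0`, ON the stratum) and the oddness of `λ₂(T)`.
g28 had this for `r = 3`; the parity bit adds `r = 4`. [cite: Fukuda1994, Thm. 1 (2), p. 264] [cite: Schettler2014, Thm. 2] [cite: Washington1997, Thm. 10.8 and §13.3 Thm. 13.13] -/
theorem classicalLambda_eq_three_of_rankCert_le_four (hFK : ferreroKida_classicalLambda_two_imaginaryQuadratic)
    (ht : ∀ x : ℚ, ¬ HasRationalTwoTorsionX W x) (hs : OnKilfordStratumAtTwo W)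
    {d : ℕ} (hd : Squarefree d) (hodd : Odd d) (h2 : 2 < d) {q : ℚ} (hq : q ≠ 0) (hΔ : W.Δ = -(d : ℚ) * q ^ 2)
    {δ : AlgebraicClosure ℚ} (hδ : δ ^ 2 = ((W.Δ : ℚ) : AlgebraicClosure ℚ))
    (κT : ZpExtension (W.divisionField 2) 2) (hκT : κT.IsCyclotomic)
    {n : ℕ} (hcert : classGroupPRank κT (n + 1) = classGroupPRank κT n) (h4 : classGroupPRank κT n ≤ 4) :
    classicalLambda κT = 3 := by
  have hΔneg : W.Δ < 0 := by
    rw [hΔ]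
    have hq2 : 0 < q ^ 2 := by positivity
    have hdpos : (0 : ℚ) < d := by exact_mod_cast (by omega : 0 < d)
    nlinarith
  haveI : Fact (Nat.Prime 2) := ⟨Nat.prime_two⟩
  -- a cyclotomic `ℤ₂`-extension of the resolvent exists; its parity bit is all we use
  have hδint : IsIntegral ℚ δ := ((AlgebraicClosure.isAlgebraic ℚ).isAlgebraic δ).isIntegral
  haveI : FiniteDimensional ℚ ℚ⟮δ⟯ := IntermediateField.adjoin.finiteDimensional hδint
  haveI : NumberField ℚ⟮δ⟯ := NumberField.mk
  obtain ⟨κ, hκ⟩ := ZpExtension.exists_isCyclotomic_holds ℚ⟮δ⟯ 2 (GaloisRep.cyclotomicCharacter_range_infinite ℚ⟮δ⟯ 2)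
  obtain ⟨hμT, h3, hle⟩ := three_le_classicalLambda_and_le_of_rankCert_divisionField_two W ht hΔneg hs κT hκT hcert
  obtain ⟨-, -, hoddT⟩ := odd_classicalLambda_divisionField_two_of_onKilfordStratumAtTwo W hFK hs hd hodd h2 hq hΔ hδ κ hκ κT hκT hμT
  obtain ⟨m, hm⟩ := hoddT
  omega

/-- The same with value exactly `4`: **`rank₂ Cl(T_{n+1}) = rank₂ Cl(T_n) = 4` ⟹ `λ₂(ℚ(W[2])^{cyc}) = 3`** (CONDITIONAL on `hFK`; Kilford sub-cell).
[cite: Fukuda1994, Thm. 1 (2), p. 264] [cite: Schettler2014, Thm. 2] -/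
theorem classicalLambda_eq_three_of_rankCert_eq_four (hFK : ferreroKida_classicalLambda_two_imaginaryQuadratic)
    (ht : ∀ x : ℚ, ¬ HasRationalTwoTorsionX W x) (hs : OnKilfordStratumAtTwo W)
    {d : ℕ} (hd : Squarefree d) (hodd : Odd d) (h2 : 2 < d) {q : ℚ} (hq : q ≠ 0) (hΔ : W.Δ = -(d : ℚ) * q ^ 2)
    {δ : AlgebraicClosure ℚ} (hδ : δ ^ 2 = ((W.Δ : ℚ) : AlgebraicClosure ℚ))
    (κT : ZpExtension (W.divisionField 2) 2) (hκT : κT.IsCyclotomic)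
    {n : ℕ} (hcert : classGroupPRank κT (n + 1) = classGroupPRank κT n) (h4 : classGroupPRank κT n = 4) :
    classicalLambda κT = 3 :=
  classicalLambda_eq_three_of_rankCert_le_four W hFK ht hs hd hodd h2 hq hΔ hδ κT hκT hcert h4.le

/-- **No certificate pins an EVEN `λ`** on the Kilford sub-cell (CONDITIONAL on `hFK`): if `μ₂(ℚ(W[2])) = 0` then `classicalLambda κT ≠ 2k` for every `k`; with a
certificate of value `r`, `λ₂(T) ∈ {3, 5, …, r or r−1}`. [cite: Schettler2014, Thm. 2] [cite: Washington1997, Thm. 10.8] -/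
theorem classicalLambda_ne_two_mul_of_onKilfordStratumAtTwo (hFK : ferreroKida_classicalLambda_two_imaginaryQuadratic)
    (hs : OnKilfordStratumAtTwo W) {d : ℕ} (hd : Squarefree d) (hodd : Odd d) (h2 : 2 < d) {q : ℚ} (hq : q ≠ 0) (hΔ : W.Δ = -(d : ℚ) * q ^ 2)
    {δ : AlgebraicClosure ℚ} (hδ : δ ^ 2 = ((W.Δ : ℚ) : AlgebraicClosure ℚ))
    (κT : ZpExtension (W.divisionField 2) 2) (hκT : κT.IsCyclotomic) (hμ : ClassicalMuVanishes κT) (k : ℕ) :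
    classicalLambda κT ≠ 2 * k := by
  haveI : Fact (Nat.Prime 2) := ⟨Nat.prime_two⟩
  have hδint : IsIntegral ℚ δ := ((AlgebraicClosure.isAlgebraic ℚ).isAlgebraic δ).isIntegral
  haveI : FiniteDimensional ℚ ℚ⟮δ⟯ := IntermediateField.adjoin.finiteDimensional hδint
  haveI : NumberField ℚ⟮δ⟯ := NumberField.mk
  obtain ⟨κ, hκ⟩ := ZpExtension.exists_isCyclotomic_holds ℚ⟮δ⟯ 2 (GaloisRep.cyclotomicCharacter_range_infinite ℚ⟮δ⟯ 2)
  obtain ⟨-, -, hoddT⟩ := odd_classicalLambda_divisionField_two_of_onKilfordStratumAtTwo W hFK hs hd hodd h2 hq hΔ hδ κ hκ κT hκT hμ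
  obtain ⟨m, hm⟩ := hoddT
  omega

/-! ## §5 (appended) The QUANTITATIVE lower bound `λ₂(ℚ(W[2])) ≥ Σ_{p ∣ d} 2^{ord₂(p²−1)−3} − 1` and the census numbers -/

/-- ★ **`λ₂(ℚ(W[2])^{cyc}) + 1 ≥ Σ_{p ∣ d, p odd} 2^{ord₂(p²−1)−3}`** — `W/ℚ` elliptic with `Δ_W = −d·q²` (`d > 2` squarefree, `q ∈ ℚˣ`), `δ² = Δ_W`, `κT` ANY cyclotomic
`ℤ₂`-extension of `ℚ(W[2])` with `μ = 0` (the C2 input); CONDITIONAL on Ferrero–Kida (`hFK`: the right side is `λ₂(ℚ(√−d)) + 1`) and this seat's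
`λ₂(ℚ(√Δ_W)) ≤ λ₂(ℚ(W[2]))` (`…ResolventParity`, unconditional).  CENSUS NUMBERS (the twelve certified Kilford seeds, `Δ_min = −d·m²`, all `d ≡ 7 (mod 8)`):
`d = 1727 = 11·157`, `2071 = 19·109`, `4087 = 61·67` (4087a1, 4087c1, 12261b1), `503` (9557a1), `6551` (19653d1), `1607` (8035a1): `Σ = 2`, `λ₂(ℚ(√−d)) = 1`, bound `λ₂(T) ≥ 1`
(g28: `≥ 3`); `d = 2351` (25861b1, 25861e1): `Σ = 4`, `λ₂(ℚ(√−d)) = 3`; **`d = 7831 = 41·191` (7831a1): `Σ = 2 + 16 = 18`, so `λ₂(ℚ(W[2])) ≥ 17`**;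
**`d = 8071 = 7·1153` (24213c1): `Σ = 2 + 32 = 34`, so `λ₂(ℚ(W[2])) ≥ 33`** — for these two seeds every 2-rank certificate `rank₂ Cl(T_{n+1}) = rank₂ Cl(T_n) = r`
has `r ≥ 17` resp. `r ≥ 33` (g28: `λ₂ ≤ r`), i.e. the sextic tower's `2`-ranks must climb that high before they can stabilise (arithmetic done by hand from the tree's
`M<seed>_Δ`; not kernel-checked here). [cite: Schettler2014, Thm. 2] [cite: Washington1997, §13.3 Thm. 13.13] [cite: Iwasawa1973MuInvariants, §3] -/
theorem ferreroKidaSum_le_classicalLambda_divisionField_two_succ (hFK : ferreroKida_classicalLambda_two_imaginaryQuadratic)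
    {d : ℕ} (hd : Squarefree d) (h2 : 2 < d) {q : ℚ} (hq : q ≠ 0) (hΔ : W.Δ = -(d : ℚ) * q ^ 2)
    {δ : AlgebraicClosure ℚ} (hδ : δ ^ 2 = ((W.Δ : ℚ) : AlgebraicClosure ℚ))
    (κT : ZpExtension (W.divisionField 2) 2) (hκT : κT.IsCyclotomic) (hμ : ClassicalMuVanishes κT) :
    ∑ p ∈ d.primeFactors.erase 2, 2 ^ (padicValNat 2 (p ^ 2 - 1) - 3) ≤ classicalLambda κT + 1 := by
  haveI : Fact (Nat.Prime 2) := ⟨Nat.prime_two⟩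
  have hδint : IsIntegral ℚ δ := ((AlgebraicClosure.isAlgebraic ℚ).isAlgebraic δ).isIntegral
  haveI : FiniteDimensional ℚ ℚ⟮δ⟯ := IntermediateField.adjoin.finiteDimensional hδint
  haveI : NumberField ℚ⟮δ⟯ := NumberField.mk
  obtain ⟨κ, hκ⟩ := ZpExtension.exists_isCyclotomic_holds ℚ⟮δ⟯ 2 (GaloisRep.cyclotomicCharacter_range_infinite ℚ⟮δ⟯ 2)
  obtain ⟨hK2, hη⟩ := exists_sq_eq_neg_of_sq_eq W h2 hq hΔ hδ
  obtain ⟨-, hsum⟩ := hFK ℚ⟮δ⟯ d hd h2 hK2 hη κ hκ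
  obtain ⟨-, hle, -⟩ := classicalLambda_divisionField_two_modEq_two_resolvent W (not_isSquare_Δ_of_eq_neg_mul_sq W h2 hq hΔ) hδ κ hκ κT hκT hμ
  rw [← hsum]
  exact Nat.add_le_add_right hle 1

/-- **With a rank certificate: `Σ_{p ∣ d} 2^{ord₂(p²−1)−3} ≤ rank₂ Cl(T_n) + 1`** on the Kilford sub-cell (`W` with no rational `2`-torsion abscissa, ON the stratum; `d`,
`q`, `δ` as above): g28's `λ₂(T) ≤ r` composed with §5.  For 7831a1 / 24213c1 a certificate needs `r ≥ 17` / `r ≥ 33`.  CONDITIONAL on `hFK`.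
[cite: Fukuda1994, Thm. 1 (2), p. 264] [cite: Schettler2014, Thm. 2] -/
theorem ferreroKidaSum_le_classGroupPRank_succ_of_rankCert (hFK : ferreroKida_classicalLambda_two_imaginaryQuadratic)
    (ht : ∀ x : ℚ, ¬ HasRationalTwoTorsionX W x) (hs : OnKilfordStratumAtTwo W)
    {d : ℕ} (hd : Squarefree d) (h2 : 2 < d) {q : ℚ} (hq : q ≠ 0) (hΔ : W.Δ = -(d : ℚ) * q ^ 2)
    {δ : AlgebraicClosure ℚ} (hδ : δ ^ 2 = ((W.Δ : ℚ) : AlgebraicClosure ℚ))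
    (κT : ZpExtension (W.divisionField 2) 2) (hκT : κT.IsCyclotomic)
    {n : ℕ} (hcert : classGroupPRank κT (n + 1) = classGroupPRank κT n) :
    ∑ p ∈ d.primeFactors.erase 2, 2 ^ (padicValNat 2 (p ^ 2 - 1) - 3) ≤ classGroupPRank κT n + 1 := by
  have hΔneg : W.Δ < 0 := by
    rw [hΔ]
    have hq2 : 0 < q ^ 2 := by positivity
    have hdpos : (0 : ℚ) < d := by exact_mod_cast (by omega : 0 < d)
    nlinarith
  haveI : Fact (Nat.Prime 2) := ⟨Nat.prime_two⟩
  obtain ⟨hμT, -, hle⟩ := three_le_classicalLambda_and_le_of_rankCert_divisionField_two W ht hΔneg hs κT hκT hcert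
  exact (ferreroKidaSum_le_classicalLambda_divisionField_two_succ W hFK hd h2 hq hΔ hδ κT hκT hμT).trans (Nat.add_le_add_right hle 1)

end Summit.BirchSwinnertonDyer.BirchSwinnertonDyer.Theorems.AlignedTransportAtTwoResolventLambdaParity

end
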